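import Summits.ABC.ABC.Theses.IsogenyGlueCongruence
import Summits.ABC.ABC.Theorems.IsogenyGlueCongruenceDegreePrimeCongruence
import HarnessLib

/-!
# Route IsogenyGlueCongruence — the `K`-line glue: `DegreePrimeCongruence ∧ K ⟹ A`

The route's fallback line runs through crux K = `TorsionSharingPrimeBound` (stmt-ABC-2157, the
per-partner level form of the torsion-sharing bound: a congruence of `f_W` with another newform `g`
of level `M` modulo a prime above `ℓ` forces `ℓ ≤ C (M N)^κ`) and the support item
`DegreePrimeCongruence` (stmt-ABC-14828: every prime `ℓ ∣ deg φ` of a suitable parametrisation of a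
semistable `W` is `≤ 163` or such a congruence prime with a partner of level `M ∣ N`). This file
proves the glue `DegreePrimeCongruence → K → A` to crux A = `DegreePrimesPolyBounded`
(stmt-ABC-2045: every prime factor of the modular degree is `≤ C' N^{κ'}`), with `κ' = 2κ`,
`C' = max C 163` — pure bookkeeping — and, feeding in the tree's conditional proof
`degreePrimeCongruence_of_facts` (`IsogenyGlueCongruenceDegreePrimeCongruence.lean`), the
conditional result `K → A` granted the three named facts `exists_isNewformOf` (modularity),
`PastenShimura2024_thm_5_5` (Ribet's `m_E ∣ r_E` in Pasten's form) and
`PastenShimura2024_minimalDegree_le_163_mul` (Mazur–Kenku). The hypothesis `hDPC` of the first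
theorem is the signature of stmt-ABC-14828 written out (its route decl is not yet materialised in
the route file, rev 8).
-/

-- `Summit.<Summit>.<Problem>` is the mandated summit-side namespace (CONVENTIONS §2); for the
-- single-conjunct summit `ABC` the two coincide, so the duplicate `ABC.ABC` is deliberate.
set_option linter.dupNamespace false

noncomputable section

namespace Summit.ABC.ABC.Theorems

open Summit.ABC.ABC.Theses.IsogenyGlueCongruence

/-- **The `K`-line glue of route `IsogenyGlueCongruence`: `DegreePrimeCongruence` and
`TorsionSharingPrimeBound` (crux K, stmt-ABC-2157) give crux A, `DegreePrimesPolyBounded`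
(stmt-ABC-2045)**, with exponent `2κ` and constant `max C 163` from the constants `κ ≥ 0`, `C` of
`K`. Given a semistable globally minimal `W` of conductor `N ≥ 1`, take the datum `D` of
`DegreePrimeCongruence` (item stmt-ABC-14828, here the hypothesis `hDPC`, its signature verbatim);
a prime `ℓ ∣ deg D` is either `≤ 163 ≤ max C 163 · N^{2κ}` (`N^{2κ} ≥ 1`), or a congruence prime of
`f_W` with a newform `g` of level `M ∣ N` in exactly the hypothesis shape of `K`, whence
`ℓ ≤ C (M N)^κ ≤ max C 163 · N^{2κ}` (`M ≤ N`, monotonicity of `x ↦ x^κ` for `κ ≥ 0`). Pure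
bookkeeping; no literature input. -/
theorem degreePrimesPolyBounded_of_torsionSharingPrimeBound
    (hDPC : ∀ (W : WeierstrassCurve ℚ) [W.IsElliptic] [W.IsGloballyMinimal] [NeZero (W.conductorNorm ℤ)], W.IsSemistable ℤ → ∃ D : Literature.NumberTheory.EllipticCurves.ModularForms.ModularParametrizationData W (W.conductorNorm ℤ), ∀ ℓ : ℕ, ℓ.Prime → ℓ ∣ D.modularDegree → ℓ ≤ 163 ∨ ∃ (M : ℕ) (_ : NeZero M) (g : CuspForm (CongruenceSubgroup.Gamma0 M) 2), M ∣ W.conductorNorm ℤ ∧ Literature.NumberTheory.EllipticCurves.ModularForms.IsNewform0 g ∧ ¬ Literature.NumberTheory.EllipticCurves.ModularForms.IsNewformOf W g ∧ ∃ (R : Subring ℂ) (F : Type) (_ : Field F) (_ : CharP F ℓ) (φ : R →+* F) (hg : ∀ n : ℕ, Literature.NumberTheory.EllipticCurves.ModularForms.cuspCoeff g n ∈ R), ∀ p : ℕ, p.Prime → ¬ (p ∣ M * W.conductorNorm ℤ * ℓ) → φ ⟨Literature.NumberTheory.EllipticCurves.ModularForms.cuspCoeff g p, hg p⟩ = ((W.LFunction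 p : ℤ) : F))
    (hK : TorsionSharingPrimeBound) : DegreePrimesPolyBounded := by
  unfold Summit.ABC.ABC.Theses.IsogenyGlueCongruence.DegreePrimesPolyBounded
  unfold Summit.ABC.ABC.Theses.IsogenyGlueCongruence.TorsionSharingPrimeBound at hK
  obtain ⟨κ, C, hκ, hK⟩ := hK
  refine ⟨2 * κ, max C 163, ?_⟩
  intro W _ _ _ hW
  obtain ⟨D, hD⟩ := hDPC W hW
  refine ⟨D, fun ℓ hℓ hℓD ↦ ?_⟩
  set N : ℝ := (W.conductorNorm ℤ : ℝ) with hNdef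
  have hN1 : (1 : ℝ) ≤ N := by
    have h : 1 ≤ W.conductorNorm ℤ := NeZero.one_le
    rw [hNdef]
    exact_mod_cast h
  have hN0 : (0 : ℝ) ≤ N := zero_le_one.trans hN1
  have hpow1 : (1 : ℝ) ≤ N ^ (2 * κ) := Real.one_le_rpow hN1 (by positivity)
  have hmax0 : (0 : ℝ) ≤ max C 163 := le_max_of_le_right (by norm_num)
  rcases hD ℓ hℓ hℓD with h163 | ⟨M, hM, g, hMN, hg, hng, R, F, hF, hchar, φ, hgR, hcong⟩
  · -- small primes
    have h1 : (ℓ : ℝ) ≤ 163 := by exact_mod_cast h163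
    calc (ℓ : ℝ) ≤ 163 := h1
      _ ≤ max C 163 := le_max_right _ _
      _ = max C 163 * 1 := (mul_one _).symm
      _ ≤ max C 163 * N ^ (2 * κ) := mul_le_mul_of_nonneg_left hpow1 hmax0
  · -- congruence primes, through `K`
    have hKℓ : (ℓ : ℝ) ≤ C * ((M : ℝ) * N) ^ κ :=
      @hK W _ _ _ hW M hM g hg hng ℓ hℓ R F hF hchar φ hgR hcong
    have hMle : (M : ℝ) ≤ N := by
      have h : M ≤ W.conductorNorm ℤ := Nat.le_of_dvd (NeZero.pos _) hMN
      rw [hNdef]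
      exact_mod_cast h
    have hMN0 : (0 : ℝ) ≤ (M : ℝ) * N := mul_nonneg (Nat.cast_nonneg _) hN0
    have hbase : (M : ℝ) * N ≤ N ^ (2 : ℝ) := by
      rw [Real.rpow_two, sq]
      exact mul_le_mul_of_nonneg_right hMle hN0
    have hpow : ((M : ℝ) * N) ^ κ ≤ N ^ (2 * κ) := by
      rw [Real.rpow_mul hN0]
      exact Real.rpow_le_rpow hMN0 hbase hκ
    have hpow0 : (0 : ℝ) ≤ ((M : ℝ) * N) ^ κ := Real.rpow_nonneg hMN0 κ
    calc (ℓ : ℝ) ≤ C * ((M : ℝ) * N) ^ κ := hKℓ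
      _ ≤ max C 163 * ((M : ℝ) * N) ^ κ := mul_le_mul_of_nonneg_right (le_max_left _ _) hpow0
      _ ≤ max C 163 * N ^ (2 * κ) := mul_le_mul_of_nonneg_left hpow hmax0

/-- **Crux A from crux K and three named facts.** `TorsionSharingPrimeBound` (K, stmt-ABC-2157)
implies `DegreePrimesPolyBounded` (A, stmt-ABC-2045) granted modularity (`exists_isNewformOf`),
Pasten 2024 Thm. 5.5 (`PastenShimura2024_thm_5_5`, = Ribet's `m_E ∣ r_E`) and the Mazur–Kenku bound
(`PastenShimura2024_minimalDegree_le_163_mul`): the glue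
`degreePrimesPolyBounded_of_torsionSharingPrimeBound` fed with the conditional proof
`degreePrimeCongruence_of_facts` of item stmt-ABC-14828.
[cite: PastenShimura2024, Thm. 5.5 p. 18 and §3 p. 13] -/
theorem degreePrimesPolyBounded_of_torsionSharingPrimeBound_of_facts
    (hK : TorsionSharingPrimeBound)
    (hmod : Literature.NumberTheory.EllipticCurves.ModularForms.exists_isNewformOf)
    (h55 : Literature.NumberTheory.EllipticCurves.ModularForms.PastenShimura2024_thm_5_5)
    (h163 : Literature.NumberTheory.EllipticCurves.ModularForms.PastenShimura2024_minimalDegree_le_163_mul) :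
    DegreePrimesPolyBounded :=
  degreePrimesPolyBounded_of_torsionSharingPrimeBound (degreePrimeCongruence_of_facts hmod h55 h163) hK

end Summit.ABC.ABC.Theorems

end
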